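import Summits.QuantumFields.BalabanUV.T4Continuum.Support.T4TrajectoryDensityGated

/-!
# `T4Continuum.T4TrajectoryDensityGatedNull` — THE GATED PER-FAMILY CAPSTONE WITH THE INTERIOR-POINT CLAUSE MADE CONDITIONAL:
# the real regular base `RealBaseAt` is asked only where the step's constraint set carries fluctuation mass; on a NULL window
# the totalised operation `wOp` is evaluation at `z₀` and its operator slice is free (cell `pub-balaban`, sub-cell `t4`, spine
# estimate NE1′ (node O3b/H2); NE1′ formalisation swarm `b2b-balaban-t4-ne1p-formalise-*`, leaf prover 02, own-initiative
# SUPPLIER item «F3-NULL» under the locator row S6 (HOME/GAPS.md C-ne1pleaf02-1 rider (d4)); tree target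
# `Summits/QuantumFields/BalabanUV/T4Continuum/Support/`; ADDITIVE — imports `T4TrajectoryDensityGated` ONLY; modifies nothing)

HONEST FRAMING.  Finite four-torus, rung (B)+1 only — NOT infinite volume, NOT a mass gap, NOT the Clay problem, NOT summit
progress.  «continuum YM on T⁴ ⇐ BetaPertH ∧ nine spine estimates (0/9 proved); BetaPertH ⇐ (D1) ∧ (D4) ∧ CAP+tail; G-an2-4
gates asym, D1 and NE2/3/4».  [folklore] measure theory + the lineage's own capstone proof re-run with one supplier changed;
0 sorry, 0 citations; nothing of Bałaban's densities or the cell's D-terms is asserted — births, the step law, the action binders,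
the window geometry, the defects and their rate stay binders ((w1), H2, (w2-act), (w3)⁺, (I4′)).

WHY (locator `t4/b2b-balaban-t4-ne1p-formalise-leaf-02/XREAD-F3-B16-sigma.md` §2 (d4), GAPS C-ne1pleaf02-1; print status
G-adv3-2a ∕ G-B16-16).  Leaf F-3's binder `hB : RealBaseAt (ref b k) (base b k) (𝒜 b k) (μ b k) (𝒦 b k′ (k+1))` of the capstone
`transportsFromVar_of_centredExponent_lattice_fam_gated` (hence of END-F) carries, besides the DISPLAYED reality ∕ integrability
clauses ([Balaban1989LargeFieldII] pp. 379–380 «All the expressions in the definition (1.71), for the configuration U, are real,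
and the exponential density in the integral is positive»), the clause `0 < μ (support base)` — an interior point of the real
constraint set of (1.71)∕(1.100) — which print ASSERTS («obviously positive, although it may be very small», p. 380) and never
states; GAPS G-B16-16 shows it is load-bearing for NO printed inequality: on a null domain the operation's summand vanishes
identically.  The cell's totalised operation `wOp ω μ z₀ U h := (∫ω_U)⁻¹•∫ω_U•h` IF `ω_U` is integrable with non-zero integral
ELSE `h z₀` (`T4TrajectoryDensity.wOp`) has the SAME dichotomy: if `μ (support base) = 0` then `base·e^{−𝒜'_U} = 0` a.e. for
EVERY background `U`, so `∫ ω_U = 0` and `wOp … U h = h z₀` — a background-INDEPENDENT evaluation, whose operator slice holds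
with any constant `≥ 1` as soon as `z₀ ∈ D` (the bound `m` on `D` bounds `h z₀`).  Hence `RealBaseAt` need only be asked WHERE THE
TERM IS PRESENT.

CONTENTS (§24 of the (w2)-split numbering).
* `expWeight_ae_zero_of_null`, `integral_expWeight_of_null`, `wOp_expWeight_of_null` — the null branch of `wOp`.
* `opSliceOn_wOp_of_null` — on a null window `OpSliceOn 𝒢 (wOp (expWeight base 𝒜') μ z₀) D move N 𝒦 w ϱ a` for every
  `a ≥ 1`, `z₀ ∈ D` (constant slices).
* `opSliceOn_wOp_dressed_or_null` — `T4TrajectoryDensityDressed.opSliceOn_wOp_dressed` with `hB` CONDITIONAL on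
  `μ (support base) ≠ 0` and the uniform constant `e³` (`s + s₁ ≤ 1`), given `z₀ ∈ D`.
* **`transportsFromVar_of_centredExponent_lattice_fam_gated_null`** — `…_gated` VERBATIM except: `hB` is asked only under
  `μ b k (support (base b k)) ≠ 0`, and `hD : (D b k).Nonempty` is replaced by `hz₀ : z₀ b k ∈ D b k`; SAME conclusion
  `T.TransportsFromVar (4c_δ/r) (fun i => ψ·α i) Gate`.  The Spine face (END-F-null, `Gate := budgetGate`) is
  `Spine/NE1p/DressedRootNull.lean`.
-/

namespace Summit.QuantumFields.BalabanUV.T4Continuum.T4TrajectoryDensityDressed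

open MeasureTheory Set Metric Filter
open Literature.MathematicalPhysics.QuantumFieldTheory.Balaban1983to89
open T4TermFormat T4TermFormat.Booking T4GatedBooking T4TrajectoryComparison T4TrajectoryModulus
open T4BirthChartTransport (GaugeInvariant BirthSlice RelGauge)
open T4BlockTransport (Fld NDir latMove latN latMove_zero)
open T4TrajectoryDensity

noncomputable section

/-! ## §24a The null branch of the totalised operation [folklore] -/

section Null

variable {Z : Type*} [MeasurableSpace Z] {𝒰 Dir : Type*} {F : Type*} [NormedAddCommGroup F] [NormedSpace ℂ F]
variable {move : 𝒰 → Dir → ℂ → 𝒰} {N : Dir → ℝ} {w ϱ : ℝ}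

/-- On a null constraint set the exponent-form weight vanishes a.e., for EVERY background. [folklore] -/
theorem expWeight_ae_zero_of_null {base : Z → ℝ} {μ : Measure Z} (h0 : μ (Function.support base) = 0) (𝒜 : 𝒰 → Z → ℂ)
    (U : 𝒰) : expWeight base 𝒜 U =ᵐ[μ] 0 := by
  have hb : ∀ᵐ z ∂μ, z ∉ Function.support base := measure_eq_zero_iff_ae_notMem.mp h0
  filter_upwards [hb] with z hz
  have hz0 : base z = 0 := Function.notMem_support.mp hz
  simp [expWeight, hz0]

/-- … hence its integral vanishes for every background. [folklore] -/
theorem integral_expWeight_of_null {base : Z → ℝ} {μ : Measure Z} (h0 : μ (Function.support base) = 0) (𝒜 : 𝒰 → Z → ℂ)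
    (U : 𝒰) : (∫ z, expWeight base 𝒜 U z ∂μ) = 0 := by
  rw [integral_congr_ae (expWeight_ae_zero_of_null h0 𝒜 U)]
  simp

/-- **THE NULL BRANCH**: on a null constraint set the totalised operation is evaluation at `z₀`, for every background and every
integrand (`wOp_of_neg`). [folklore] -/
theorem wOp_expWeight_of_null {base : Z → ℝ} {μ : Measure Z} (h0 : μ (Function.support base) = 0) (𝒜 : 𝒰 → Z → ℂ) (z₀ : Z)
    (U : 𝒰) (h : Z → F) : wOp (expWeight base 𝒜) μ z₀ U h = h z₀ :=
  wOp_of_neg (fun hgood => hgood.2 (integral_expWeight_of_null h0 𝒜 U)) h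

/-- **THE OPERATOR SLICE ON A NULL WINDOW IS FREE**: with `z₀ ∈ D` and any constant `a ≥ 1`, every integrand bounded by `m` on `D`
has the constant slice `U ↦ h z₀`, holomorphic everywhere and bounded by `m ≤ a·m`. [folklore] -/
theorem opSliceOn_wOp_of_null {𝒢 : Set (Z → F)} {D : Set Z} {𝒦 : Set 𝒰} {a : ℝ} {base : Z → ℝ} {μ : Measure Z}
    (h0 : μ (Function.support base) = 0) (𝒜 : 𝒰 → Z → ℂ) {z₀ : Z} (hz₀ : z₀ ∈ D) (ha : 1 ≤ a) :
    OpSliceOn 𝒢 (wOp (expWeight base 𝒜) μ z₀) D move N 𝒦 w ϱ a := by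
  intro h _ m hm U _ d _ _
  have hconst : (fun t : ℂ => wOp (expWeight base 𝒜) μ z₀ (move U d t) h) = fun _ => h z₀ := by
    funext t
    exact wOp_expWeight_of_null h0 𝒜 z₀ (move U d t) h
  refine ⟨Set.univ, ?_, ?_, fun _ _ => Set.subset_univ _⟩
  · show DifferentiableOn ℂ (fun t : ℂ => wOp (expWeight base 𝒜) μ z₀ (move U d t) h) Set.univ
    rw [hconst]
    exact differentiableOn_const _
  · intro t _
    show ‖wOp (expWeight base 𝒜) μ z₀ (move U d t) h‖ ≤ a * m
    rw [wOp_expWeight_of_null h0 𝒜 z₀ (move U d t) h]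
    have hm0 : 0 ≤ m := (norm_nonneg _).trans (hm z₀ hz₀)
    calc ‖h z₀‖ ≤ m := hm z₀ hz₀
      _ = 1 * m := (one_mul m).symm
      _ ≤ a * m := mul_le_mul_of_nonneg_right ha hm0

end Null

/-! ## §24b The dressed supplier with the real base asked only on a present window [folklore] -/

section DressedOrNull

variable {Z : Type*} [MeasurableSpace Z] {𝒰 Dir : Type*}
variable {ref : 𝒰 → 𝒰} {base : Z → ℝ} {𝒜 𝒬 : 𝒰 → Z → ℂ} {μ : Measure Z} {move : 𝒰 → Dir → ℂ → 𝒰}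
  {N : Dir → ℝ} {𝒦 : Set 𝒰} {w ϱ s s₁ : ℝ}
variable {F : Type*} [NormedAddCommGroup F] [NormedSpace ℂ F] [CompleteSpace F]

/-- **THE DRESSED STEP LAW, REAL BASE CONDITIONAL**: `opSliceOn_wOp_dressed` with `hB : RealBaseAt …` asked only when
`μ (support base) ≠ 0`, at the uniform constant `e³` (`s + s₁ ≤ 1`), given `z₀ ∈ D`.  On a present window this is the lineage's
supplier followed by `opSliceOn_mono_const`; on a null window it is `opSliceOn_wOp_of_null` (no reality, no slice, no budget used).
[folklore] -/
theorem opSliceOn_wOp_dressed_or_null {D : Set Z} {z₀ : Z} (hz₀ : z₀ ∈ D)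
    (hB : μ (Function.support base) ≠ 0 → RealBaseAt ref base 𝒜 μ 𝒦)
    (hE : ExponentSliceAt ref 𝒜 μ move N 𝒦 w ϱ s) (hP : PertSlice 𝒬 μ move N 𝒦 w ϱ s₁) (hs : s + s₁ ≤ 1)
    (hD : ∀ᵐ z ∂μ, z ∈ D) :
    OpSliceOn (BddClass F μ) (wOp (expWeight base (𝒜 + 𝒬)) μ z₀) D move N 𝒦 w ϱ (Real.exp 3) := by
  by_cases h0 : μ (Function.support base) = 0
  · exact opSliceOn_wOp_of_null h0 (𝒜 + 𝒬) hz₀ (Real.one_le_exp (by norm_num))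
  · exact opSliceOn_mono_const ⟨z₀, hz₀⟩ (opSliceOn_wOp_dressed z₀ (hB h0) hE hP hs hD)
      (Real.exp_le_exp.mpr (by linarith))

end DressedOrNull

/-! ## §24c The gated per-family capstone, interior-point clause conditional [folklore] -/

section GatedCapstoneNull

variable {B : Booking} {T : Trajectory B}
variable {R : Type*} [NormedRing R] [NormedAlgebra ℂ R] [MeasurableSpace R] {d : ℕ}
  {F : Type*} [NormedAddCommGroup F] [NormedSpace ℂ F] [CompleteSpace F]

/-- **THE PER-FAMILY CENTRED CAPSTONE, BUDGET UNDER THE HISTORY, INTERIOR-POINT CLAUSE CONDITIONAL** —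
`transportsFromVar_of_centredExponent_lattice_fam_gated` VERBATIM except: the real regular base `hB` is asked only where the
step's constraint set carries mass (`μ b k (Function.support (base b k)) ≠ 0`), and the non-emptiness of the fluctuation domain
`hD` is replaced by `hz₀ : z₀ b k ∈ D b k` (the junk point of `wOp` inside the domain).  SAME conclusion. [folklore] -/
theorem transportsFromVar_of_centredExponent_lattice_fam_gated_null {Gate : ℕ → Prop}
    {Fn : B.Birth → ℕ → ℕ → Fld d R → F}
    {rel : B.Birth → ℕ → ℕ → Fld d R → Fld d R → Prop} {𝒦 : B.Birth → ℕ → ℕ → Set (Fld d R)}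
    {ref : B.Birth → ℕ → Fld d R → Fld d R} {base : B.Birth → ℕ → Fld d R → ℝ}
    {𝒜 𝒬 : B.Birth → ℕ → Fld d R → Fld d R → ℂ} {q : B.Birth → ℕ → Fld d R → ℂ}
    {μ : B.Birth → ℕ → Measure (Fld d R)} {z₀ : B.Birth → ℕ → Fld d R} {D : B.Birth → ℕ → Set (Fld d R)}
    {defect : B.Birth → ℕ → ℕ → ℝ} {cδ ψ w r : ℝ} {s s₁ θ : B.Birth → ℕ → ℝ} {α : ℕ → ℝ}
    {ϱ : B.Birth → ℕ → ℕ → ℝ}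
    (hα : ∀ i, 0 ≤ α i) (hr : 0 < r) (hw : 0 < w)
    (hsl : ∀ (b : B.Birth) (k' : ℕ), B.birthScale b ≤ k' → k' ≤ B.K → RanBelow Gate k' →
      BirthSlice (Fn b k' k') latMove latN (𝒦 b k' k') w r (T.gen b k'))
    (hFn : ∀ (b : B.Birth) (k' k : ℕ), B.birthScale b ≤ k' → k' ≤ k → k + 1 ≤ B.K → RanBelow Gate (k + 1) →
      ∀ U, Fn b k' (k + 1) U =
        wOp (expWeight (base b k) (𝒜 b k + 𝒬 b k)) (μ b k) (z₀ b k) U (fun z => Fn b k' k (U + z)))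
    (h𝒢 : ∀ (b : B.Birth) (k' k : ℕ), B.birthScale b ≤ k' → k' ≤ k → k + 1 ≤ B.K → RanBelow Gate (k + 1) →
      ∀ U, (fun z => Fn b k' k (U + z)) ∈ BddClass F (μ b k))
    (hz₀ : ∀ b k, z₀ b k ∈ D b k) (hϱ : ∀ b k' k, 0 < ϱ b k' k)
    (hB : ∀ (b : B.Birth) (k' k : ℕ), B.birthScale b ≤ k' → k' ≤ k → k + 1 ≤ B.K → RanBelow Gate (k + 1) →
      μ b k (Function.support (base b k)) ≠ 0 →
      RealBaseAt (ref b k) (base b k) (𝒜 b k) (μ b k) (𝒦 b k' (k + 1)))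
    (hE : ∀ (b : B.Birth) (k' k : ℕ), B.birthScale b ≤ k' → k' ≤ k → k + 1 ≤ B.K → RanBelow Gate (k + 1) →
      ExponentSliceAt (ref b k) (𝒜 b k) (μ b k) latMove latN (𝒦 b k' (k + 1)) w (ϱ b k' k) (s b k))
    (hP : ∀ (b : B.Birth) (k' k : ℕ), B.birthScale b ≤ k' → k' ≤ k → k + 1 ≤ B.K → RanBelow Gate (k + 1) →
      PertSlice (fun U z => 𝒬 b k U z - q b k U) (μ b k) latMove latN (𝒦 b k' (k + 1)) w (ϱ b k' k) (s₁ b k))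
    (hs : ∀ (b : B.Birth) (k' k : ℕ), B.birthScale b ≤ k' → k' ≤ k → k + 1 ≤ B.K → RanBelow Gate (k + 1) →
      s b k + s₁ b k ≤ 1)
    (hDμ : ∀ b k, ∀ᵐ z ∂μ b k, z ∈ D b k)
    (hN1 : ∀ (b : B.Birth) (k' k : ℕ), B.birthScale b ≤ k' → k' ≤ k → k + 1 ≤ B.K →
      ∀ z ∈ D b k, ∀ U ∈ 𝒦 b k' (k + 1), U + z ∈ 𝒦 b k' k)
    (hN2 : ∀ (b : B.Birth) (k' k : ℕ), B.birthScale b ≤ k' → k' ≤ k → k + 1 ≤ B.K →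
      ∀ U₀ ∈ 𝒦 b k' (k + 1), ∀ p : NDir d R, latN p ≤ w → ∀ z' ∈ D b k, latMove U₀ p 1 + z' ∈ 𝒦 b k' k)
    (hdiam : ∀ b k, ∀ z ∈ D b k, ∀ z' ∈ D b k, ∀ x ν, ‖z x ν - z' x ν‖ ≤ θ b k)
    (hθ : ∀ b k, 0 < θ b k ∧ θ b k ≤ w)
    (hdom : ∀ (b : B.Birth) (k' k : ℕ), B.birthScale b ≤ k' → k' ≤ k → k + 1 ≤ B.K →
      Real.exp 3 * (1 + 4 * θ b k / ϱ b k' k) ≤ α k)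
    (hinv : ∀ b k' k, GaugeInvariant (rel b k' k) (Fn b k' k))
    (hdefw : ∀ b k' k, defect b k' k ≤ w)
    (hrate : ∀ (b : B.Birth) (k' k : ℕ), B.birthScale b ≤ k' → k' ≤ k → k ≤ B.K →
      defect b k' k ≤ cδ * ψ ^ (k - k'))
    (hlin : ∀ (b : B.Birth) (k' k : ℕ), B.birthScale b ≤ k' → k' ≤ k → k ≤ B.K → RanBelow Gate k → ∀ ε > 0,
      ∃ U₀ ∈ 𝒦 b k' k, ∃ U₁ : Fld d R, RelGauge (rel b k' k) latMove latN U₀ U₁ (defect b k' k) ∧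
        T.lin b k' k ≤ ‖Fn b k' k U₁ - Fn b k' k U₀‖ + ε) :
    T.TransportsFromVar (4 * cδ / r) (fun i => ψ * α i) Gate := by
  have e : ∀ b k, 𝒜 b k + 𝒬 b k = (𝒜 b k + fun U z => 𝒬 b k U z - q b k U) + fun U _ => q b k U := fun b k => by
    funext U z
    simp only [Pi.add_apply]
    ring
  have hFn' : ∀ (b : B.Birth) (k' k : ℕ), B.birthScale b ≤ k' → k' ≤ k → k + 1 ≤ B.K → RanBelow Gate (k + 1) →
      ∀ U, Fn b k' (k + 1) U =
        wOp (expWeight (base b k) (𝒜 b k + fun U z => 𝒬 b k U z - q b k U)) (μ b k) (z₀ b k) U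
          (fun z => Fn b k' k (U + z)) := by
    intro b k' k h₁ h₂ h₃ h₄ U
    rw [hFn b k' k h₁ h₂ h₃ h₄ U, e b k, wOp_expWeight_add_zconst]
  exact transportsFromVar_of_linearOpSlicesOn_lattice_fam (𝒢 := fun b k => BddClass F (μ b k))
    (E := fun b k => wOp (expWeight (base b k) (𝒜 b k + fun U z => 𝒬 b k U z - q b k U)) (μ b k) (z₀ b k))
    (a := fun _ _ => Real.exp 3) (ϱ := ϱ) (θ := θ)
    hα hr hw hsl hFn' h𝒢 (fun b k => ⟨z₀ b k, hz₀ b k⟩) hϱ (fun b k c => const_mem_bddClass (μ b k) c)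
    (fun b k _ hg _ hg' => sub_mem_bddClass hg hg')
    (fun b k U _ hg _ hg' => wOp_sub _ (μ b k) (z₀ b k) U hg hg')
    (fun b k U c => wOp_const _ (μ b k) (z₀ b k) U c)
    (fun b k' k hbk' hk'k hk hran =>
      opSliceOn_wOp_dressed_or_null (hz₀ b k) (hB b k' k hbk' hk'k hk hran) (hE b k' k hbk' hk'k hk hran)
        (hP b k' k hbk' hk'k hk hran) (hs b k' k hbk' hk'k hk hran) (hDμ b k))
    hN1 hN2 hdiam hθ hdom hinv hdefw hrate hlin

end GatedCapstoneNull

end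

end Summit.QuantumFields.BalabanUV.T4Continuum.T4TrajectoryDensityDressed
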